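import Mathlib.NumberTheory.Padics.PadicVal.Basic
import Mathlib.Analysis.SpecialFunctions.Log.Basic
import Summits.ABC.IUTFork.Cor312IdentifiedNonVacuitySigns
import HarnessLib

/-!
# The naive `p`-adic model for the Cor. 3.12 adjudication, I: `p`-adic balls, their hull frame and log-volume

Record-only file (D-0012) of the abc-iut cell (D-0067 adjudication, ADJUDICATION-SPEC §2 (G3) / §4 (iii): the
«G-NV» ask of abc-iut-w4-d041 for a countermodel whose [IUTchIII] Thm. 3.11 instance is CONTENTFUL; seat
abc-iut-w5-d247); TAKES NO SIDE.  Part I of three (`Cor312NaivePadicBalls` ⟵ `Cor312NaiveThm311` ⟵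
`Cor312GapWitnessContentful`).  Over c312-7's one-place index `Cor312.Checks.toyIndex` (`l⋇ = 2`) and
abc-iut-w4-d101's sign shells (`signShells`: carrier `ℚ`, Ism `= {±1}`; packet lines `line j vQ : Packet ≃ ℚ`;
`actsBySigns_of_mem_closure`), this file supplies the volume geometry of the NAIVE MODEL — the model in which all
copies are consistently identified and the indeterminacies act by isometries ([cite: ScholzeStix2018, §2.2 pp. 9–10]):
* `pBall p j vQ k` — the `p`-ADIC BALL `{x | line x = 0 ∨ v_p(line x) ≥ k}` of a packet ("`λ·𝒪`"); nested,
  injective in `k`, never `{0}`, never everything (`pBall_subset_iff`, `pBall_succ_ssubset`, `pBall_ne_univ`);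
* `image_pBall_of_mem_closure` — EVERY element of the group generated by (Ind1), (Ind2) (c312-1's
  `Ind1Family ∪ Ind2Family`) maps every ball ONTO ITSELF (it multiplies the line coordinate by `±1`);
* `pFrame` — c312-7's `HullFrame` with hull-sets the balls ([IUTchIII] Rmk. 3.9.5 (i)): the smallest ball
  containing a bounded set with an element of extremal valuation EXISTS (`hull_mem` proved), `hull B_k = B_k`;
* `pVol` — the log-volume `μ(B_k) = −k·log p` ([IUTchIII] Prop. 3.9 (i), normalised `μ(B_0) = 0`), monotone.
No judgement on print; no `Prop` fact; standard axioms. [claim: Mochizuki2012, status: disputed]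
-/

noncomputable section

namespace Summit.ABC

namespace IUTFork

namespace Cor312Vol

namespace NaiveWitness

open Thm311 Cor312 Cor312.Checks Cor312.IdentifiedNonVacuity Literature.IUT.LogThetaLattice

variable (p : ℕ)

/-! ## 1. `p`-adic balls on the packet lines -/

/-- The `p`-ADIC BALL `B_k := {x | line(x) = 0 ∨ v_p(line x) ≥ k}` of "radius `p^{−k}`" in a tensor packet
of the sign shells (the hull-sets `λ·𝒪` of [IUTchIII] Rmk. 3.9.5 (i) in the naive model).
[claim: Mochizuki2012, status: disputed] -/
def pBall (j : toyIndex.Label) (vQ : toyIndex.VQ) (k : ℤ) : Set (signShells.Packet j vQ) :=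
  {x | line j vQ x = 0 ∨ k ≤ padicValRat p (line j vQ x)}

/-- `0 ∈ B_k`. [folklore] -/
theorem zero_mem_pBall (j : toyIndex.Label) (vQ : toyIndex.VQ) (k : ℤ) :
    (0 : signShells.Packet j vQ) ∈ pBall p j vQ k :=
  Or.inl (map_zero _)

/-- The balls are NESTED: `B_k ⊆ B_{k'}` for `k' ≤ k`. [folklore] -/
theorem pBall_mono (j : toyIndex.Label) (vQ : toyIndex.VQ) {k k' : ℤ} (h : k' ≤ k) :
    pBall p j vQ k ⊆ pBall p j vQ k' := by
  rintro x (hx | hx)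
  · exact Or.inl hx
  · exact Or.inr (h.trans hx)

/-- The point `p^k` of the packet line (an element of `B_k` of exact valuation `k`). [folklore] -/
def pt (j : toyIndex.Label) (vQ : toyIndex.VQ) (k : ℤ) : signShells.Packet j vQ :=
  (line j vQ).symm ((p : ℚ) ^ k)

/-- `line (p^k) = p^k`. [folklore] -/
theorem line_pt (j : toyIndex.Label) (vQ : toyIndex.VQ) (k : ℤ) :
    line j vQ (pt p j vQ k) = (p : ℚ) ^ k :=
  LinearEquiv.apply_symm_apply _ _

/-- `p^k ≠ 0` in `ℚ`. [folklore] -/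
theorem ppow_ne_zero [hp : Fact p.Prime] (k : ℤ) : ((p : ℚ) ^ k) ≠ 0 :=
  zpow_ne_zero k (Nat.cast_ne_zero.mpr hp.out.ne_zero)

/-- `v_p(p^k) = k`. [folklore] -/
theorem padicValRat_ppow [hp : Fact p.Prime] (k : ℤ) : padicValRat p ((p : ℚ) ^ k) = k := by
  rw [padicValRat.zpow, padicValRat.self hp.out.one_lt, mul_one]

/-- `p^k ∈ B_k`. [folklore] -/
theorem pt_mem_pBall [hp : Fact p.Prime] (j : toyIndex.Label) (vQ : toyIndex.VQ) (k : ℤ) :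
    pt p j vQ k ∈ pBall p j vQ k :=
  Or.inr (by rw [line_pt, padicValRat_ppow])

/-- `p^k ∈ B_{k'}` iff `k' ≤ k`. [folklore] -/
theorem pt_mem_pBall_iff [hp : Fact p.Prime] (j : toyIndex.Label) (vQ : toyIndex.VQ) (k k' : ℤ) :
    pt p j vQ k ∈ pBall p j vQ k' ↔ k' ≤ k := by
  constructor
  · rintro (h | h)
    · exact absurd ((line_pt p j vQ k).symm.trans h) (ppow_ne_zero p k)
    · rwa [line_pt, padicValRat_ppow] at h
  · intro h; exact pBall_mono p j vQ h (pt_mem_pBall p j vQ k)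

/-- `B_k ⊆ B_{k'}` iff `k' ≤ k`. [folklore] -/
theorem pBall_subset_iff [hp : Fact p.Prime] (j : toyIndex.Label) (vQ : toyIndex.VQ) (k k' : ℤ) :
    pBall p j vQ k ⊆ pBall p j vQ k' ↔ k' ≤ k :=
  ⟨fun h => (pt_mem_pBall_iff p j vQ k k').1 (h (pt_mem_pBall p j vQ k)), pBall_mono p j vQ⟩

/-- `k ↦ B_k` is injective. [folklore] -/
theorem pBall_injective [hp : Fact p.Prime] (j : toyIndex.Label) (vQ : toyIndex.VQ) :
    Function.Injective (pBall p j vQ) :=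
  fun k k' h =>
    le_antisymm ((pBall_subset_iff p j vQ k' k).1 h.symm.le) ((pBall_subset_iff p j vQ k k').1 h.le)

/-- `B_{k+1} ⊊ B_k`: the balls are PROPER subsets of one another. [folklore] -/
theorem pBall_succ_ssubset [hp : Fact p.Prime] (j : toyIndex.Label) (vQ : toyIndex.VQ) (k : ℤ) :
    pBall p j vQ (k + 1) ⊂ pBall p j vQ k :=
  ⟨pBall_mono p j vQ (by omega), fun h => by
    have := (pBall_subset_iff p j vQ k (k + 1)).1 h; omega⟩

/-- No ball is the whole packet (`p^{k−1} ∉ B_k`). [folklore] -/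
theorem pBall_ne_univ [hp : Fact p.Prime] (j : toyIndex.Label) (vQ : toyIndex.VQ) (k : ℤ) :
    pBall p j vQ k ≠ Set.univ := by
  intro h
  have := (pt_mem_pBall_iff p j vQ (k - 1) k).1 (h ▸ Set.mem_univ _)
  omega

/-- No ball is `{0}`. [folklore] -/
theorem pBall_ne_zero [hp : Fact p.Prime] (j : toyIndex.Label) (vQ : toyIndex.VQ) (k : ℤ) :
    pBall p j vQ k ≠ {0} := by
  intro h
  have h1 : pt p j vQ k ∈ ({0} : Set _) := h ▸ pt_mem_pBall p j vQ k
  have h2 := congrArg (line j vQ) (Set.mem_singleton_iff.1 h1)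
  rw [line_pt, map_zero] at h2
  exact ppow_ne_zero p k h2

/-! ## 2. The (Ind1),(Ind2)-group fixes every ball -/

/-- Multiplication by a sign does not change `v_p` and vanishing. [folklore] -/
theorem sign_mul_mem_pBall_iff {ε : ℚ} (hε : |ε| = 1) (k : ℤ) (c : ℚ) :
    (ε * c = 0 ∨ k ≤ padicValRat p (ε * c)) ↔ (c = 0 ∨ k ≤ padicValRat p c) := by
  rcases (abs_eq (zero_le_one' ℚ)).1 hε with rfl | rfl
  · rw [one_mul]
  · rw [neg_one_mul, neg_eq_zero, padicValRat.neg]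

/-- **A family acting by signs FIXES every `p`-adic ball** (as a set). [folklore] -/
theorem image_pBall_of_actsBySigns {Φ : signShells.PacketAut} (h : ActsBySigns Φ) (j : toyIndex.Label)
    (vQ : toyIndex.VQ) (k : ℤ) : Φ j vQ '' pBall p j vQ k = pBall p j vQ k := by
  obtain ⟨ε, hε, hΦ⟩ := h.sign j vQ
  apply Set.Subset.antisymm
  · rintro _ ⟨x, hx, rfl⟩
    show line j vQ (Φ j vQ x) = 0 ∨ k ≤ padicValRat p (line j vQ (Φ j vQ x))
    rw [hΦ, sign_mul_mem_pBall_iff p hε k]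
    exact hx
  · intro x hx
    refine ⟨(Φ j vQ).symm x, ?_, LinearEquiv.apply_symm_apply _ _⟩
    have h1 := hΦ ((Φ j vQ).symm x)
    rw [LinearEquiv.apply_symm_apply] at h1
    show line j vQ ((Φ j vQ).symm x) = 0 ∨ k ≤ padicValRat p (line j vQ ((Φ j vQ).symm x))
    rw [← sign_mul_mem_pBall_iff p hε k, ← h1]
    exact hx

/-- Every element of the group generated by (Ind1), (Ind2) fixes every ball. [folklore] -/
theorem image_pBall_of_mem_closure {Φ : signShells.PacketAut}
    (h : Φ ∈ Subgroup.closure (signShells.Ind1Family ∪ signShells.Ind2Family)) (j : toyIndex.Label)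
    (vQ : toyIndex.VQ) (k : ℤ) : Φ j vQ '' pBall p j vQ k = pBall p j vQ k :=
  image_pBall_of_actsBySigns p (actsBySigns_of_mem_closure h) j vQ k

/-! ## 3. The hull frame of `p`-adic balls and the log-volume `μ(B_k) = −k·log p` -/

/-- The HULL FRAME of the naive model on a packet: hull-sets the balls `B_k`, `k ∈ ℤ`; "relatively compact"
= inside some ball; "admits a hull" = bounded with an element of EXACT extremal valuation (then the smallest
ball containing the set exists: [IUTchIII] Rmk. 3.9.5 (i) "the smallest subset of the form `λ·𝒪` that
contains" it). [claim: Mochizuki2012, status: disputed] -/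
def pFrame (j : toyIndex.Label) (vQ : toyIndex.VQ) : HullFrame (signShells.Packet j vQ) where
  Hul := Set.range (pBall p j vQ)
  IsBounded := fun U => ∃ k, U ⊆ pBall p j vQ k
  HasHull := fun U =>
    ∃ k, U ⊆ pBall p j vQ k ∧ ∃ x ∈ U, line j vQ x ≠ 0 ∧ padicValRat p (line j vQ x) = k
  hul_bounded := by rintro _ ⟨k, rfl⟩; exact ⟨k, subset_rfl⟩
  bounded_mono := fun U U' hUU' ⟨k, hk⟩ => ⟨k, hUU'.trans hk⟩
  exists_hul := fun U ⟨k, hk⟩ => ⟨pBall p j vQ k, ⟨k, rfl⟩, hk⟩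
  hull_mem := by
    rintro U - ⟨k, hUk, x, hxU, hx0, hxk⟩
    refine ⟨k, ?_⟩
    apply Set.Subset.antisymm
    · refine Set.subset_sInter ?_
      rintro H ⟨⟨k', rfl⟩, hUH⟩
      refine pBall_mono p j vQ ?_
      rcases hUH hxU with h | h
      · exact absurd h hx0
      · rwa [hxk] at h
    · exact Set.sInter_subset_of_mem ⟨⟨k, rfl⟩, hUk⟩

/-- The hull of a ball is itself. [folklore] -/
theorem pFrame_hull_pBall (j : toyIndex.Label) (vQ : toyIndex.VQ) (k : ℤ) :
    (pFrame p j vQ).hull (pBall p j vQ k) = pBall p j vQ k := by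
  refine Set.Subset.antisymm ((pFrame p j vQ).hull_subset_of_mem ⟨k, rfl⟩ subset_rfl)
    ((pFrame p j vQ).subset_hull _)

/-- A ball is bounded and admits its hull. [folklore] -/
theorem pFrame_bounded_hasHull [hp : Fact p.Prime] (j : toyIndex.Label) (vQ : toyIndex.VQ) (k : ℤ) :
    (pFrame p j vQ).IsBounded (pBall p j vQ k) ∧ (pFrame p j vQ).HasHull (pBall p j vQ k) :=
  ⟨⟨k, subset_rfl⟩, ⟨k, subset_rfl, pt p j vQ k, pt_mem_pBall p j vQ k,
    by rw [line_pt]; exact ppow_ne_zero p k, by rw [line_pt, padicValRat_ppow]⟩⟩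

open scoped Classical in
/-- The LOG-VOLUME of the naive model: `μ(B_k) = −k·log p` on balls (normalised by `μ(B_0) = 0`,
[IUTchIII] Prop. 3.9 (i)), `0` on non-balls (never evaluated there). [claim: Mochizuki2012, status: disputed] -/
def pVol (j : toyIndex.Label) (vQ : toyIndex.VQ) (A : Set (signShells.Packet j vQ)) : ℝ :=
  if h : ∃ k, A = pBall p j vQ k then -(h.choose : ℝ) * Real.log p else 0

/-- `μ(B_k) = −k·log p`. [folklore] -/
theorem pVol_pBall [hp : Fact p.Prime] (j : toyIndex.Label) (vQ : toyIndex.VQ) (k : ℤ) :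
    pVol p j vQ (pBall p j vQ k) = -(k : ℝ) * Real.log p := by
  classical
  have h : ∃ k', pBall p j vQ k = pBall p j vQ k' := ⟨k, rfl⟩
  unfold pVol
  rw [dif_pos h, pBall_injective p j vQ h.choose_spec.symm]

/-- `log p > 0`. [folklore] -/
theorem log_p_pos [hp : Fact p.Prime] : 0 < Real.log p :=
  Real.log_pos (by exact_mod_cast hp.out.one_lt)

/-- The log-volume is monotone on balls. [folklore] -/
theorem pVol_mono [hp : Fact p.Prime] {j : toyIndex.Label} {vQ : toyIndex.VQ} {k k' : ℤ}
    (h : pBall p j vQ k ⊆ pBall p j vQ k') :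
    pVol p j vQ (pBall p j vQ k) ≤ pVol p j vQ (pBall p j vQ k') := by
  rw [pVol_pBall, pVol_pBall]
  have hk : (k' : ℝ) ≤ k := by exact_mod_cast (pBall_subset_iff p j vQ k k').1 h
  nlinarith [log_p_pos p]

end NaiveWitness

end Cor312Vol

end IUTFork

end Summit.ABC

end
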